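import Mathlib
import Literature.Analysis.FluidPDE.AxisymHouLiVariables
import Literature.Analysis.FluidPDE.AxisymmetricVorticityTransport
import Literature.Analysis.FluidPDE.AxisymmetricLiftR5
import Literature.Analysis.FluidPDE.AxisymNoSwirlCoSignedFlux
import Literature.Analysis.FluidPDE.VectorCalculusProofs
import Literature.Analysis.FluidPDE.LerayProfileCalculus
import HarnessLib

/-!
# Scaling tools for the AXISYMMETRIC SWIRL-FREE strata of the crux
# `EulerZoomLiouville.PowerGaugeEulerLiouville` (route №10, item stmt-NavierStokesRegularity-19832)

Helper file (theorems only; `--supports stmt-NavierStokesRegularity-19832`). Seat ns-typeII-p3 (cell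
ns-regularity-ideate §B, D-0081), rungs C2 ∩ C3 / C1 ∩ C3 of `Cruxes/PowerGaugeEulerLiouville/Lines/rungC_window.lean`.

For the quantity `η = ω_θ/r = angVortQuot u` (Hou–Li / KNSS / Ukhovskii–Yudovich) of an axisymmetric
field this file records how it transforms under the dilations `w(y) = c • v(λ y)` that generate the
class scaling `(S_l u)(τ,y) = l^{1+ρ} u(l^{2+ρ}τ, l y)` of Seregin's power-gauged class:

* `hasFDerivAt_smul_comp_smul`, `curl_smul_comp_smul`, `swirl_curl_smul_comp_smul` — `Dw(y) = cλ Dv(λy)`,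
  `curl w (y) = cλ curl v (λy)`, `swirl (curl w) (y) = c swirl (curl v) (λy)`;
* `isAxisymmetric_smul_comp_smul` — dilations preserve axisymmetry;
* `angVortQuot_smul_comp_smul` — **`η_w(y) = c λ² η_v(λ y)`** everywhere (off the axis by
  `r² η = swirl (curl ·)`, across it by continuity);
* `integral_angVortQuot_sq_smul_comp_smul` — **`∫ η_w² = c² λ ∫ η_v²`** (`λ > 0`; change of variables
  `y ↦ λy` in `ℝ³`), and `integrable_angVortQuot_sq_smul_comp_smul_iff`;
* `fderiv_inner_symm_of_curl_eq_zero` — `curl v (x) = 0` ⇒ `Dv(x)` is symmetric (via the tree's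
  `‖curl v‖² = ½ |Dv − Dvᵀ|²`);
* `curl_eq_zero_of_angVortQuot_eq_zero` — for an axisymmetric swirl-free `C³` field, `η ≡ 0 ⇒ curl v ≡ 0`
  (`curl v = η · Jx`).

With `c = l^{1+ρ}`, `λ = l` this gives `η_{S_l u}(τ, y) = l^{3+ρ} η_u(l^{2+ρ}τ, l y)` and
`‖η_{S_l u}(τ)‖₂² = l^{3+2ρ} ‖η_u(l^{2+ρ}τ)‖₂²` — the exponent mismatch that, against the CONSERVATION of
`‖η(τ)‖₂` along swirl-free Euler flows (sequel `…AxisymNoSwirlTransport.lean`), kills discretely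
self-similar axisymmetric swirl-free members (sequel `…AxisymNoSwirlDSS.lean`). Mechanism in print for
OTHER transported quantities: Chae, CMP 273 (2007) Thm 2.2 (abstract `L^{p₁} ∩ L^{p₂}` version, applied to
`r v^θ` with swirl); Chae–Tsai, MRL 21 (2014) Thm 2.1 (general 3-D vorticity, all small `q`). WHAT THIS IS
NOT: not NS, not the crux — calculus of dilations. [folklore]
-/

noncomputable section

-- the summit and its single problem share the name `NavierStokesRegularity` (D-0017 nested layout)
set_option linter.dupNamespace false

open Set Function Filter Topology MeasureTheory Metric Module
open scoped NNReal ENNReal InnerProductSpace RealInnerProductSpace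

namespace Summit.NavierStokesRegularity.NavierStokesRegularity.Theorems.PowerGaugeEulerLiouville.AxisymNoSwirl

open Literature.Analysis Literature.Analysis.FluidPDE

/-! ## Dilations `w(y) = c • v(λ y)` -/

/-- `D(c • v(λ ·))(y) = (cλ) • Dv(λy)`. [folklore] -/
theorem hasFDerivAt_smul_comp_smul {v : (EuclideanSpace ℝ (Fin 3)) → (EuclideanSpace ℝ (Fin 3))} (c lam : ℝ) {y : (EuclideanSpace ℝ (Fin 3))}
    (hv : DifferentiableAt ℝ v (lam • y)) :
    HasFDerivAt (fun z : (EuclideanSpace ℝ (Fin 3)) => c • v (lam • z)) ((c * lam) • fderiv ℝ v (lam • y)) y := by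
  have h1 : HasFDerivAt (fun z : (EuclideanSpace ℝ (Fin 3)) => lam • z) (lam • ContinuousLinearMap.id ℝ (EuclideanSpace ℝ (Fin 3))) y :=
    (hasFDerivAt_id y).const_smul lam
  have h2 : HasFDerivAt (fun z : (EuclideanSpace ℝ (Fin 3)) => v (lam • z)) ((fderiv ℝ v (lam • y)).comp
      (lam • ContinuousLinearMap.id ℝ (EuclideanSpace ℝ (Fin 3)))) y := hv.hasFDerivAt.comp y h1
  have h3 := h2.const_smul c
  refine h3.congr_fderiv ?_
  ext1 z
  simp [smul_smul]

/-- `D(c • v(λ ·))(y) = (cλ) • Dv(λy)` (`fderiv` form). [folklore] -/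
theorem fderiv_smul_comp_smul {v : (EuclideanSpace ℝ (Fin 3)) → (EuclideanSpace ℝ (Fin 3))} (c lam : ℝ) {y : (EuclideanSpace ℝ (Fin 3))}
    (hv : DifferentiableAt ℝ v (lam • y)) :
    fderiv ℝ (fun z : (EuclideanSpace ℝ (Fin 3)) => c • v (lam • z)) y = (c * lam) • fderiv ℝ v (lam • y) :=
  (hasFDerivAt_smul_comp_smul c lam hv).fderiv

/-- `curl (c • v(λ ·)) (y) = (cλ) • curl v (λy)`. [folklore] -/
theorem curl_smul_comp_smul {v : (EuclideanSpace ℝ (Fin 3)) → (EuclideanSpace ℝ (Fin 3))} (hv : Differentiable ℝ v) (c lam : ℝ) (y : (EuclideanSpace ℝ (Fin 3))) :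
    curl (fun z : (EuclideanSpace ℝ (Fin 3)) => c • v (lam • z)) y = (c * lam) • curl v (lam • y) := by
  have hD := fderiv_smul_comp_smul c lam (hv (lam • y))
  ext i
  fin_cases i <;>
    simp [curl, hD, PiLp.smul_apply, smul_eq_mul] <;> ring

/-- `swirl (curl (c • v(λ ·))) (y) = c · swirl (curl v) (λy)`. [folklore] -/
theorem swirl_curl_smul_comp_smul {v : (EuclideanSpace ℝ (Fin 3)) → (EuclideanSpace ℝ (Fin 3))} (hv : Differentiable ℝ v) (c lam : ℝ) (y : (EuclideanSpace ℝ (Fin 3))) :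
    swirl (curl (fun z : (EuclideanSpace ℝ (Fin 3)) => c • v (lam • z))) y = c * swirl (curl v) (lam • y) := by
  simp only [swirl, curl_smul_comp_smul hv, PiLp.smul_apply, smul_eq_mul]
  ring

/-- Dilations preserve axisymmetry: `v` axisymmetric ⇒ `c • v(λ ·)` axisymmetric. [folklore] -/
theorem isAxisymmetric_smul_comp_smul {v : (EuclideanSpace ℝ (Fin 3)) → (EuclideanSpace ℝ (Fin 3))} (hax : IsAxisymmetric v) (c lam : ℝ) :
    IsAxisymmetric (fun z : (EuclideanSpace ℝ (Fin 3)) => c • v (lam • z)) := by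
  intro θ x
  have h1 : lam • rotZ θ x = rotZ θ (lam • x) := by
    rw [← rotZL_apply, ← rotZL_apply, (rotZL θ).map_smul]
  have h2 : rotZ θ (c • v (lam • x)) = c • rotZ θ (v (lam • x)) := by
    rw [← rotZL_apply, ← rotZL_apply, (rotZL θ).map_smul]
  simp only [h1, hax θ (lam • x), h2]

/-- Dilations preserve the absence of swirl (`λ ≠ 0`). [folklore] -/
theorem hasNoSwirl_smul_comp_smul {v : (EuclideanSpace ℝ (Fin 3)) → (EuclideanSpace ℝ (Fin 3))} (hsw : HasNoSwirl v) (c : ℝ) {lam : ℝ}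
    (hlam : lam ≠ 0) : HasNoSwirl (fun z : (EuclideanSpace ℝ (Fin 3)) => c • v (lam • z)) := by
  intro x
  have h := hsw (lam • x)
  simp only [swirl, PiLp.smul_apply, smul_eq_mul] at h ⊢
  have : lam * (x 0 * (c * v (lam • x) 1) - x 1 * (c * v (lam • x) 0)) = c * 0 := by
    rw [← h]; ring
  simpa [hlam] using this

/-- `c • v(λ ·)` is `Cⁿ` when `v` is. [folklore] -/
theorem contDiff_smul_comp_smul {v : (EuclideanSpace ℝ (Fin 3)) → (EuclideanSpace ℝ (Fin 3))} {n : ℕ∞} (hv : ContDiff ℝ n v) (c lam : ℝ) :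
    ContDiff ℝ n (fun z : (EuclideanSpace ℝ (Fin 3)) => c • v (lam • z)) :=
  (hv.comp (contDiff_const_smul lam)).const_smul c

/-- **`η_w(y) = c λ² η_v(λ y)`** for `w = c • v(λ ·)`, `v ∈ C³` axisymmetric: the Ukhovskii–Yudovich
quantity `η = ω_θ/r = angVortQuot` under dilations (off the axis from `r² η = swirl (curl ·)` and
`r(λy) = |λ| r(y)`; across the axis by continuity). [folklore] -/
theorem angVortQuot_smul_comp_smul {v : (EuclideanSpace ℝ (Fin 3)) → (EuclideanSpace ℝ (Fin 3))} (hax : IsAxisymmetric v) (hv : ContDiff ℝ 3 v)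
    (c lam : ℝ) :
    angVortQuot (fun z : (EuclideanSpace ℝ (Fin 3)) => c • v (lam • z)) = fun y => c * lam ^ 2 * angVortQuot v (lam • y) := by
  have hw3 : ContDiff ℝ 3 (fun z : (EuclideanSpace ℝ (Fin 3)) => c • v (lam • z)) := contDiff_smul_comp_smul hv c lam
  have haxw : IsAxisymmetric (fun z : (EuclideanSpace ℝ (Fin 3)) => c • v (lam • z)) := isAxisymmetric_smul_comp_smul hax c lam
  have hvd : Differentiable ℝ v := hv.differentiable (by norm_num)
  have hL : Continuous (angVortQuot (fun z : (EuclideanSpace ℝ (Fin 3)) => c • v (lam • z))) :=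
    (contDiff_angVortQuot (n := 0) (by exact_mod_cast hw3)).continuous
  have hR : Continuous (fun y : (EuclideanSpace ℝ (Fin 3)) => c * lam ^ 2 * angVortQuot v (lam • y)) :=
    continuous_const.mul ((contDiff_angVortQuot (n := 0) (by exact_mod_cast hv)).continuous.comp
      (continuous_const_smul lam))
  funext y
  refine eq_of_eq_off_ker (EuclideanSpace.proj (0 : Fin 3)) ⟨EuclideanSpace.single 0 1, by simp⟩
    hL hR (fun z hz => ?_) y
  have hz0 : z 0 ≠ 0 := by simpa using hz
  have hr : cylRadius z ^ 2 ≠ 0 := pow_ne_zero 2 fun h => hz0 ((cylRadius_eq_zero_iff z).1 h).1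
  have h1 := haxw.cylRadius_sq_mul_angVortQuot hw3 z
  have h2 := hax.cylRadius_sq_mul_angVortQuot hv (lam • z)
  rw [swirl_curl_smul_comp_smul hvd, ← h2, cylRadius_smul, mul_pow, sq_abs] at h1
  apply mul_left_cancel₀ hr
  rw [h1]; ring

/-- **`∫ η_w² = c² λ ∫ η_v²`** for `w = c • v(λ ·)`, `λ > 0` (`η_w(y)² = c²λ⁴ η_v(λy)²` and
`∫ f(λy) dy = λ⁻³ ∫ f`). [folklore] -/
theorem integral_angVortQuot_sq_smul_comp_smul {v : (EuclideanSpace ℝ (Fin 3)) → (EuclideanSpace ℝ (Fin 3))} (hax : IsAxisymmetric v)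
    (hv : ContDiff ℝ 3 v) (c : ℝ) {lam : ℝ} (hlam : 0 < lam) :
    ∫ y, angVortQuot (fun z : (EuclideanSpace ℝ (Fin 3)) => c • v (lam • z)) y ^ 2 =
      c ^ 2 * lam * ∫ y, angVortQuot v y ^ 2 := by
  rw [angVortQuot_smul_comp_smul hax hv c lam]
  have h1 : (fun y : (EuclideanSpace ℝ (Fin 3)) => (c * lam ^ 2 * angVortQuot v (lam • y)) ^ 2) =
      fun y : (EuclideanSpace ℝ (Fin 3)) => (c * lam ^ 2) ^ 2 * (fun z : (EuclideanSpace ℝ (Fin 3)) => angVortQuot v z ^ 2) (lam • y) := by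
    funext y; ring
  rw [h1, integral_const_mul, Measure.integral_comp_smul volume (fun z : (EuclideanSpace ℝ (Fin 3)) => angVortQuot v z ^ 2) lam,
    finrank_euclideanSpace_fin, abs_of_pos (inv_pos.2 (pow_pos hlam 3)), smul_eq_mul]
  field_simp

/-- Square-integrability of `η` is dilation invariant (`λ ≠ 0`). [folklore] -/
theorem integrable_angVortQuot_sq_smul_comp_smul_iff {v : (EuclideanSpace ℝ (Fin 3)) → (EuclideanSpace ℝ (Fin 3))} (hax : IsAxisymmetric v)
    (hv : ContDiff ℝ 3 v) {c lam : ℝ} (hc : c ≠ 0) (hlam : lam ≠ 0) :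
    Integrable (fun y => angVortQuot (fun z : (EuclideanSpace ℝ (Fin 3)) => c • v (lam • z)) y ^ 2) ↔
      Integrable (fun y => angVortQuot v y ^ 2) := by
  rw [angVortQuot_smul_comp_smul hax hv c lam]
  have h1 : (fun y : (EuclideanSpace ℝ (Fin 3)) => (c * lam ^ 2 * angVortQuot v (lam • y)) ^ 2) =
      fun y : (EuclideanSpace ℝ (Fin 3)) => (c * lam ^ 2) ^ 2 * (fun z : (EuclideanSpace ℝ (Fin 3)) => angVortQuot v z ^ 2) (lam • y) := by
    funext y; ring
  rw [h1]
  have hk : (c * lam ^ 2) ^ 2 ≠ 0 := pow_ne_zero 2 (mul_ne_zero hc (pow_ne_zero 2 hlam))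
  rw [integrable_const_mul_iff (isUnit_iff_ne_zero.2 hk)]
  exact integrable_comp_smul_iff volume (fun z : (EuclideanSpace ℝ (Fin 3)) => angVortQuot v z ^ 2) hlam

/-! ## From `η ≡ 0` to a symmetric velocity gradient -/

/-- `curl v (x) = 0` ⇒ `Dv(x)` is symmetric (tree: `‖curl v(x)‖² = ½ |Dv(x) − Dv(x)ᵀ|²`). [folklore] -/
theorem fderiv_inner_symm_of_curl_eq_zero {v : (EuclideanSpace ℝ (Fin 3)) → (EuclideanSpace ℝ (Fin 3))} {x : (EuclideanSpace ℝ (Fin 3))} (hv : DifferentiableAt ℝ v x)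
    (h : curl v x = 0) (a b : (EuclideanSpace ℝ (Fin 3))) : ⟪fderiv ℝ v x a, b⟫ = ⟪fderiv ℝ v x b, a⟫ := by
  have h1 := norm_curl_sq_eq_frobeniusNormSq_spin_holds v x hv
  rw [h, norm_zero] at h1
  have h2 : frobeniusNormSq (spin v x) = 0 := by nlinarith [frobeniusNormSq_nonneg (spin v x)]
  have h3 : spin v x = 0 := eq_zero_of_frobeniusNormSq_eq_zero h2
  have h4 : fderiv ℝ v x = ContinuousLinearMap.adjoint (fderiv ℝ v x) := by
    have : fderiv ℝ v x - ContinuousLinearMap.adjoint (fderiv ℝ v x) = 0 := by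
      simpa [spin] using h3
    exact sub_eq_zero.1 this
  calc ⟪fderiv ℝ v x a, b⟫ = ⟪ContinuousLinearMap.adjoint (fderiv ℝ v x) a, b⟫ := by rw [← h4]
    _ = ⟪a, fderiv ℝ v x b⟫ := ContinuousLinearMap.adjoint_inner_left _ _ _
    _ = ⟪fderiv ℝ v x b, a⟫ := real_inner_comm _ _

/-- For an axisymmetric swirl-free `C³` field, `η = angVortQuot v ≡ 0` forces `curl v ≡ 0`
(`curl v = η · Jx`, tree `curl_eq_hadamardQuotFst_smul_rotGen` + `angVortQuot_eq_hadamardQuotFst_curl`).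
[folklore] -/
theorem curl_eq_zero_of_angVortQuot_eq_zero {v : (EuclideanSpace ℝ (Fin 3)) → (EuclideanSpace ℝ (Fin 3))} (hax : IsAxisymmetric v) (hsw : HasNoSwirl v)
    (hv : ContDiff ℝ 3 v) (h : ∀ x, angVortQuot v x = 0) (x : (EuclideanSpace ℝ (Fin 3))) : curl v x = 0 := by
  have hv2 : ContDiff ℝ 2 v := hv.of_le (by norm_num)
  rw [curl_eq_hadamardQuotFst_smul_rotGen hax hsw hv2 x,
    ← congrFun (angVortQuot_eq_hadamardQuotFst_curl hax hsw hv) x, h x, zero_smul]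

/-- The trace of the gradient of a divergence-free field vanishes, in the coordinate form used by the
irrotational stratum (`∑ⱼ Dv(x) eⱼ · eⱼ = 0`). [folklore] -/
theorem sum_fderiv_single_apply_eq_zero_of_isDivFree {v : (EuclideanSpace ℝ (Fin 3)) → (EuclideanSpace ℝ (Fin 3))} (hdiv : VectorCalculus.IsDivFree v)
    (x : (EuclideanSpace ℝ (Fin 3))) : ∑ j, fderiv ℝ v x (EuclideanSpace.single j (1 : ℝ)) j = 0 := by
  have h := hdiv x
  rw [divergence_eq_sum_three] at h
  simpa [Fin.sum_univ_three] using h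

end Summit.NavierStokesRegularity.NavierStokesRegularity.Theorems.PowerGaugeEulerLiouville.AxisymNoSwirl

end
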